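import Summits.QuantumFields.YangMills.Theses.ThermalDescent
import Literature.MathematicalPhysics.QuantumFieldTheory.WilsonFinTorusSpectralData
import Literature.Analysis.OperatorTheory.PositiveKernelSpectralTraceTwoSucc
import Literature.Analysis.OperatorTheory.HeterogeneousCyclicPeeling

/-!
# `ThermalDescent.HsTransfer` (stmt-QuantumFields-27307) — registered stub `stub_chainSpectral`

The two-insertion cyclic chain `(Xk, K^(a₀+1), Xkᵀ, K²)` of the Osterwalder–Seiler slice kernel
`K = finTorusSliceKernel r.ρ β` (`β ≥ 0`) with an arbitrary bounded strongly measurable bond kernel `Xk` and its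
transpose is the non-negative double spectral sum `Σ_(i,j) λⱼ^(a₀+1) λᵢ² Mᵢⱼ²` over an eigenbasis of the transfer
operator, `0 ≤ λᵢ ≤ λ_(i₀) = transferSpectralRadius r.ρ β S`, `Mᵢⱼ = ⟪bᵢ, 𝒳 bⱼ⟫` independent of `a₀`:
`integral_cyclic_insert_two` + `hasSum_integral_iterate_insert_two_succ` + (kernel transpose = `L²` adjoint).
Proves the stub of the registered skeleton `Cruxes/NT/Lines/thermal_descent_hs_birth.lean` by name and signature.
No summit, leg or spine crux is proved here.
-/

set_option autoImplicit false
set_option maxHeartbeats 1600000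

namespace Summit.QuantumFields.YangMills.Theorems.ThermalDescentHsTransfer

open MeasureTheory Filter Function Literature.Analysis.OperatorTheory Literature.MathematicalPhysics.QuantumFieldTheory
open scoped RealInnerProductSpace ENNReal

/-- Registered stub `stub_chainSpectral` of `HsTransfer` (stmt-QuantumFields-27307): the `:=`-free, instance-generic
(`[MeasurableSpace G] [BorelSpace G]`) form of the skeleton stub `stub_twoInsertionSpectral`; the skeleton applies it at
`borel G`. [folklore] -/
theorem stub_chainSpectral : ∀ (G : Type) [Group G] [TopologicalSpace G] [IsTopologicalGroup G] [CompactSpace G] [MeasurableSpace G] [BorelSpace G], Literature.MathematicalPhysics.QuantumFieldTheory.IsCompactSimpleLieGroup G → ∀ (r : Literature.MathematicalPhysics.QuantumFieldTheory.LatticeRep G) (β : ℝ) (S : ℕ) [NeZero S], 0 ≤ β → ∀ (Xk : (Literature.MathematicalPhysics.QuantumFieldTheory.FinSpatialSite S S S × Fin 3 → G) → (Literature.MathematicalPhysics.QuantumFieldTheory.FinSpatialSite S S S × Fin 3 → G) → ℝ) (CX : ℝ), MeasureTheory.StronglyMeasurable (Function.uncurry Xk) → (∀ x y, ‖Xk x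 y‖ ≤ CX) → ∃ (ι : Type) (lam : ι → ℝ) (i₀ : ι) (M : ι × ι → ℝ), (∀ i, 0 ≤ lam i ∧ lam i ≤ lam i₀) ∧ Literature.MathematicalPhysics.QuantumFieldTheory.transferSpectralRadius r.ρ β S = lam i₀ ∧ ∀ a₀ : ℕ, HasSum (fun p : ι × ι => lam p.2 ^ (a₀ + 1) * lam p.1 ^ 2 * M p ^ 2) (∫ V : Fin (1 + ((a₀ + 1) + (1 + 1)) + 1) → (Literature.MathematicalPhysics.QuantumFieldTheory.FinSpatialSite S S S × Fin 3 → G), ∏ t : Fin (1 + ((a₀ + 1) + (1 + 1)) + 1), (fun n : ℕ => if n = 0 then Xk else if n = a₀ + 1 + 1 then (fun x y => Xk y x) else Literature.MathematicalPhysics.QuantumFieldTheory.finTorusSliceKernel r.ρ β) (t : ℕ) (V t) (V (t + 1)) ∂MeasureTheory.Measure.pi (fun _ => MeasureTheory.Measure.pi (fun _ : Literature.MathematicalPhysics.QuantumFieldTheory.FinSpatialSite S S S × Fin 3 => Literature.MathematicalPhysics.QuantumFieldTheory.haarProbability G))) := by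
  intro G _ _ _ _ _ _ hG r β S _ hβ Xk CX hXm hXb
  haveI : SecondCountableTopology G :=
    (r.continuous.isClosedEmbedding r.injective).isEmbedding.secondCountableTopology
  -- the slice space and the transfer kernel
  set μ : Measure (FinSpatialSite S S S × Fin 3 → G) :=
    Measure.pi fun _ : FinSpatialSite S S S × Fin 3 => haarProbability G with hμ
  set K : (FinSpatialSite S S S × Fin 3 → G) → (FinSpatialSite S S S × Fin 3 → G) → ℝ :=
    finTorusSliceKernel r.ρ β with hKdef
  have hK : StronglyMeasurable (uncurry K) := stronglyMeasurable_uncurry_finTorusSliceKernel r.ρ r.continuous β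
  obtain ⟨C, hC⟩ := exists_norm_finTorusSliceKernel_le (b₁ := S) (b₂ := S) (b₃ := S) r.ρ r.continuous β
  have hsymm : ∀ x y, K x y = K y x := finTorusSliceKernel_symm r.ρ r.mem_unitary β
  have hKpos : ∀ x y, 0 < K x y := finTorusSliceKernel_pos r.ρ r.continuous β
  obtain ⟨A, hA⟩ := exists_kernelOp (μ := μ) hK hC
  have hsa : IsSelfAdjoint A := isSelfAdjoint_kernelOp hK hC hsymm hA
  have hC0 : 0 ≤ C := (norm_nonneg _).trans (hC 1 1)
  have hcpt : IsCompactOperator A := isCompactOperator_kernelOp hC hC0 hA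
  have himp : IsPositivityImproving A := isPositivityImproving_kernelOp hK hC hKpos hA
  have hA0 : A ≠ 0 := kernelOp_ne_zero hK hC hKpos (IsProbabilityMeasure.ne_zero _) hA
  obtain ⟨s, b, lam, hbs, hb0⟩ := exists_hilbertBasis_eigenvectors_of_isSelfAdjoint hcpt hsa
  have hb : ∀ i, A (b i) = lam i • b i := fun i => by simpa using hb0 i
  haveI : Fact ((2 : ℝ≥0∞) ≠ ⊤) := ⟨ENNReal.ofNat_ne_top⟩
  have hon : Orthonormal ℝ ((↑) : s → Lp ℝ 2 μ) := hbs ▸ b.orthonormal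
  haveI : Countable s := (hon.countable_of_separableSpace (𝕜 := ℝ)).to_subtype
  have hlam0 : ∀ i, 0 ≤ lam i := fun i => by
    rw [lam_eq_inner hb i]
    exact inner_kernelOp_self_nonneg hA (posType_finTorusSliceKernel r.ρ r.continuous r.mem_unitary hβ) _
  obtain ⟨ψ, hψ0, hψ⟩ := himp.exists_top_eigenvector_of_isCompactOperator hsa hcpt hA0
  obtain ⟨i₀, hi₀⟩ := exists_index_eq_norm b hsa hb hψ0 hψ
  have hle : ∀ i, lam i ≤ lam i₀ := fun i => (le_abs_self _).trans ((abs_lam_le_norm hb i).trans hi₀.ge)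
  have hL0 : 0 < lam i₀ := by rw [hi₀]; exact norm_pos_iff.2 hA0
  have hS := hasSum_lam_sq hK hC hA hb
  have hZ : ∀ m : ℕ, HasSum (fun i => lam i ^ (m + 2)) (wilsonFinTorusPartition r.ρ β S S S (m + 2)) := fun m => by
    rw [wilsonFinTorusPartition_eq_integral_prod_finTorusSliceKernel_succ r.ρ r.continuous β S S S m]
    exact hasSum_pow_integral_cyclic hK hC hsymm hA hb hlam0 m
  have hrad : transferSpectralRadius r.ρ β S = lam i₀ := by
    refine limsup_rpow_eq_of_hasSum_pow hlam0 hle hL0 hS.summable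
      (Z := fun m => cyclicPartition r.ρ β S (m + 1)) fun n => ?_
    have h := hZ n
    rw [wilsonFinTorusPartition_eq_cyclicPartition r.continuous r.mem_unitary] at h
    exact h
  -- the insertion operators `𝒳` (kernel `Xk`) and `𝒳'` (the transposed kernel)
  have hXtm : StronglyMeasurable (uncurry fun x y => Xk y x) := by
    have : (uncurry fun x y => Xk y x) = uncurry Xk ∘ Prod.swap := by
      funext z; rfl
    rw [this]
    exact hXm.comp_measurable measurable_swap
  have hXtb : ∀ x y, ‖(fun x y => Xk y x) x y‖ ≤ CX := fun x y => hXb y x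
  obtain ⟨Xop, hXop⟩ := exists_kernelOp (μ := μ) hXm hXb
  obtain ⟨Xop', hXop'⟩ := exists_kernelOp (μ := μ) hXtm hXtb
  -- kernel transpose = adjoint: `⟪bⱼ, 𝒳' bᵢ⟫ = ⟪bᵢ, 𝒳 bⱼ⟫`
  have hadj : ∀ i j, ⟪(b j : Lp ℝ 2 μ), Xop' (b i)⟫ = ⟪(b i : Lp ℝ 2 μ), Xop (b j)⟫ := fun i j => by
    have e1 : ⟪(b j : Lp ℝ 2 μ), Xop' (b i)⟫ =
        ∫ z, (b j : Lp ℝ 2 μ) z.1 * ((fun x y => Xk y x) z.1 z.2 * (b i : Lp ℝ 2 μ) z.2) ∂(μ.prod μ) := by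
      rw [inner_kernelOp_eq_integral hXop', integral_prod _ (integrable_mul_kernel_mul hXtm hXtb (b j) (b i))]
      refine integral_congr_ae (Eventually.of_forall fun x => ?_)
      exact (integral_const_mul ((b j : Lp ℝ 2 μ) x) _).symm
    have e2 : ⟪(b i : Lp ℝ 2 μ), Xop (b j)⟫ =
        ∫ z, (b i : Lp ℝ 2 μ) z.1 * (Xk z.1 z.2 * (b j : Lp ℝ 2 μ) z.2) ∂(μ.prod μ) := by
      rw [inner_kernelOp_eq_integral hXop, integral_prod _ (integrable_mul_kernel_mul hXm hXb (b i) (b j))]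
      refine integral_congr_ae (Eventually.of_forall fun x => ?_)
      exact (integral_const_mul ((b i : Lp ℝ 2 μ) x) _).symm
    rw [e1, e2, ← integral_prod_swap]
    refine integral_congr_ae (Eventually.of_forall fun z => ?_)
    simp only [Prod.fst_swap, Prod.snd_swap]
    ring
  refine ⟨s, lam, i₀, fun p => ⟪(b p.1 : Lp ℝ 2 μ), Xop (b p.2)⟫, fun i => ⟨hlam0 i, hle i⟩, hrad, fun a₀ => ?_⟩
  -- common bound for the three kernels, then the path-space → iterate form
  have hXb' : ∀ x y, ‖Xk x y‖ ≤ max C CX := fun x y => (hXb x y).trans (le_max_right _ _)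
  have hXtb' : ∀ x y, ‖(fun x y => Xk y x) x y‖ ≤ max C CX := fun x y => (hXb y x).trans (le_max_right _ _)
  have hKb' : ∀ x y, ‖K x y‖ ≤ max C CX := fun x y => (hC x y).trans (le_max_left _ _)
  rw [integral_cyclic_insert_two (ρ := μ) hXm.measurable hXtm.measurable hK.measurable hXb' hXtb' hKb' (a₀ + 1) 1]
  have h5 := hasSum_integral_iterate_insert_two_succ hK hC hsymm hA hb hXm hXb hXop hXtm hXtb hXop' a₀ 0
  simp only [zero_add] at h5
  convert h5 using 2 with p
  rw [hadj p.1 p.2]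
  ring

end Summit.QuantumFields.YangMills.Theorems.ThermalDescentHsTransfer
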